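import Literature.MathematicalPhysics.QuantumLattice.GrassmannLinearSubstitution
import Literature.MathematicalPhysics.QuantumLattice.GrassmannIntegralSubstitution
import Literature.MathematicalPhysics.QuantumLattice.GrassmannEffectiveActionBlocks
import Literature.MathematicalPhysics.QuantumLattice.GrassmannParity
import Literature.MathematicalPhysics.QuantumLattice.GrassmannKernelsPresented
import HarnessLib

/-!
# Decoupled identical copies of a Grassmann Gaussian integral: the effective action is the sum of the embedded copies

Topic `MathematicalPhysics/QuantumLattice`; continuation of `GrassmannEffectiveActionBlocks` (two decoupled blocks of fields:
`effAction C (V₁ + V₂) = effAction C V₁ + effAction C V₂`) and `GrassmannLinearSubstitution` (covariance of `effAction` and of the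
kernels under an arbitrary linear substitution of the generators).  A BLOCK STRUCTURE on a label set `Γ'` is a bijection
`e : Γ' ≃ ι × Γ` (`(e X').1` = the block of `X'`, `(e X').2` = its label inside the block; the `b²` boxes of side `L` tiling a torus of
side `bL`, each identified with the torus of side `L`).  The COPIES covariance of `C : Matrix Γ Γ R` is
`C'(X', Y') = [blk X' = blk Y'] · C(π X', π Y')` (one independent copy of `C` per block — the shape of
`GrassmannGramFormAlgebra.isGramBoundedR_blockCopies_of_gram`), and the EMBEDDING of block `β` is the substitution
`f_β : (Γ → R) →ₗ[R] (Γ' → R)`, `(f_β v)(X') = [blk X' = β] · v(π X')`, i.e. `ψ(X) ↦ ψ'(e⁻¹(β, X))` (`map_blockEmb_gen`; a witness is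
`LinearMap.pi (fun X' => if (e X').1 = β then LinearMap.proj (e X').2 else 0)`, `blockEmb_pi_apply` — every statement takes `f_β`
through this defining property only).  Then (Salmhofer 1999, Def. 2.19 (2.102)–(2.106) and §4.3 (4.84)–(4.88): independent fields
integrate separately; Berezin 1966, Ch. I §3):

* §1 `toMatrix'_blockEmb`, `map_blockEmb_gen`, `transpose_mul_copies_mul_blockEmb` (`f_βᵀ C' f_β = C`), `map_blockEmb_mem_fieldSubalgebra`
  (the copy lives on the fields of block `β`), `map_blockEmb_mem_evenOdd_zero` (and `GrassmannRelabelling.constPart_map`);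
* §2 **`effAction_copies_map_blockEmb`** — `effAction C' (V ∘ f_β) = (effAction C V) ∘ f_β` and `effPartitionFn_copies_map_blockEmb`
  (`Z` unchanged): ONE embedded copy integrates as the original (instance of `GrassmannLinearSubstitution.effAction_map`);
  **`effAction_copies_sum`** — for an even `V` without constant part and `Z(C, V)` a unit,
  `effAction C' (Σ_{β ∈ s} V ∘ f_β) = Σ_{β ∈ s} (effAction C V) ∘ f_β` and the partition function of the glued interaction is a unit
  (induction on the blocks with `effAction_add_of_blockDiag`);
* §3 `kernel_map_blockEmb`, **`kernel_copies_sum`** — the kernels of `Σ_β W ∘ f_β` vanish unless all legs lie in one block, where they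
  are the kernels of `W` at the projected legs; **`sum_pinned_kernel_copies_sum`** — every pinned (weighted) leg sum of the glued
  element equals the corresponding pinned sum of `W` (so the pinned `L¹` profiles and moments of `b²` decoupled copies of an effective
  action ARE those of one copy).

This is the «decoupled reference» `effAction C^dec V` of the nested two-volume comparison of a torus with the `b²` copies of a smaller
one (the `W` of `KLProgrammeKLRegimeTwoVolumeDefectStep.sum_norm_kernel_twoVolumeDefect_le`).  Everything is proved; no definition.

## Sources
M. Salmhofer, *Renormalization: An Introduction* (Springer 1999), Def. 2.19 (2.102)–(2.106), §4.3 (4.84)–(4.88), App. B.2 (B.23)–(B.25)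
[`Salmhofer1999`]; F. A. Berezin, *The Method of Second Quantization* (1966), Ch. I §3 [`Berezin1966`].
-/

noncomputable section

namespace Literature.MathematicalPhysics.QuantumLattice

open GrassmannAlgebra Finset

section Copies

variable (R : Type*) [CommRing R] {Γ Γ' ι : Type*} (e : Γ' ≃ ι × Γ)

/-! ### §1 The block embedding and the copies covariance -/

/-- A WITNESS of the block embedding: `LinearMap.pi (fun X' => [blk X' = β] · proj_{π X'})` acts by
`(f_β v)(X') = [blk X' = β] · v(π X')` (the linear substitution of generators of Berezin 1966, Ch. I §3). [cite: Berezin1966, Ch. I §3] -/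
theorem blockEmb_pi_apply [DecidableEq ι] (β : ι) (v : Γ → R) (X' : Γ') :
    LinearMap.pi (fun X' : Γ' => if (e X').1 = β then (LinearMap.proj (e X').2 : (Γ → R) →ₗ[R] R) else 0) v X' =
      if (e X').1 = β then v (e X').2 else 0 := by
  rw [LinearMap.pi_apply]
  split_ifs <;> rfl

variable {R}

/-- The matrix of the block embedding: `M(X', X) = [e X' = (β, X)]` (Salmhofer 1999, (B.23): the matrix of a linear change of generators). [cite: Salmhofer1999, App. B.2 (B.23)-(B.25)] -/
theorem toMatrix'_blockEmb [Fintype Γ] [DecidableEq Γ] [DecidableEq ι] {β : ι} {f : (Γ → R) →ₗ[R] (Γ' → R)}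
    (hf : ∀ v X', f v X' = if (e X').1 = β then v (e X').2 else 0) (X' : Γ') (X : Γ) :
    LinearMap.toMatrix' f X' X = if e X' = (β, X) then 1 else 0 := by
  rw [LinearMap.toMatrix'_apply, hf, Pi.single_apply]
  by_cases h1 : (e X').1 = β <;> by_cases h2 : (e X').2 = X <;> simp [h1, h2, Prod.ext_iff]

/-- **The block embedding on generators**: `ψ(X) ↦ ψ'(e⁻¹(β, X))` (Berezin 1966, Ch. I §3: the endomorphism induced by a linear map of the generators). [cite: Berezin1966, Ch. I §3] -/
theorem map_blockEmb_gen [Fintype Γ] [DecidableEq Γ] [Fintype Γ'] [DecidableEq Γ'] [DecidableEq ι] {β : ι}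
    {f : (Γ → R) →ₗ[R] (Γ' → R)} (hf : ∀ v X', f v X' = if (e X').1 = β then v (e X').2 else 0) (X : Γ) :
    ExteriorAlgebra.map f (gen R X) = gen R (e.symm (β, X)) := by
  rw [map_gen_eq_sum, Finset.sum_eq_single (e.symm (β, X))]
  · rw [toMatrix'_blockEmb e hf, if_pos (by simp), one_smul]
  · intro X' _ hX'
    rw [toMatrix'_blockEmb e hf, if_neg, zero_smul]
    intro h
    exact hX' (by rw [← h, Equiv.symm_apply_apply])
  · exact fun h => (h (mem_univ _)).elim

/-- **The copies covariance pulls back to the original along each block embedding**: `f_βᵀ C' f_β = C` for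
`C'(X', Y') = [blk X' = blk Y'] · C(π X', π Y')` (the pulled-back covariance `Mᵀ C' M` of Salmhofer 1999, (B.23)–(B.25)). [cite: Salmhofer1999, App. B.2 (B.23)-(B.25)] -/
theorem transpose_mul_copies_mul_blockEmb [Fintype Γ] [DecidableEq Γ] [Fintype Γ'] [DecidableEq ι] {β : ι}
    {f : (Γ → R) →ₗ[R] (Γ' → R)} (hf : ∀ v X', f v X' = if (e X').1 = β then v (e X').2 else 0)
    (C : Matrix Γ Γ R) (C' : Matrix Γ' Γ' R)
    (hC' : ∀ X' Y', C' X' Y' = if (e X').1 = (e Y').1 then C (e X').2 (e Y').2 else 0) :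
    (LinearMap.toMatrix' f).transpose * C' * LinearMap.toMatrix' f = C := by
  ext X Y
  simp only [Matrix.mul_apply, Matrix.transpose_apply, toMatrix'_blockEmb e hf]
  rw [Finset.sum_eq_single (e.symm (β, Y))]
  · rw [if_pos (by simp), mul_one, Finset.sum_eq_single (e.symm (β, X))]
    · rw [if_pos (by simp), one_mul, hC']
      simp
    · intro X' _ hX'
      rw [if_neg, zero_mul]
      intro h
      exact hX' (by rw [← h, Equiv.symm_apply_apply])
    · exact fun h => (h (mem_univ _)).elim
  · intro Y' _ hY'
    rw [if_neg, mul_zero]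
    intro h
    exact hY' (by rw [← h, Equiv.symm_apply_apply])
  · exact fun h => (h (mem_univ _)).elim

/-- **The embedded copy lives on the fields of block `β`** (Salmhofer 1999, §4.3 (4.84): a function of the fields `ψ₁` of one factor). [cite: Salmhofer1999, §4.3 (4.84)-(4.88)] -/
theorem map_blockEmb_mem_fieldSubalgebra [Fintype Γ'] [DecidableEq Γ'] [DecidableEq ι] {β : ι}
    {f : (Γ → R) →ₗ[R] (Γ' → R)} (hf : ∀ v X', f v X' = if (e X').1 = β then v (e X').2 else 0)
    (V : GrassmannAlgebra R Γ) :
    ExteriorAlgebra.map f V ∈ fieldSubalgebra R {X' : Γ' | (e X').1 = β} := by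
  induction V using ExteriorAlgebra.induction with
  | algebraMap r => rw [AlgHom.commutes]; exact Subalgebra.algebraMap_mem _ r
  | ι v =>
    rw [ExteriorAlgebra.map_apply_ι, ι_eq_sum_gen]
    refine Subalgebra.sum_mem _ fun X' _ => ?_
    by_cases hX' : (e X').1 = β
    · exact Subalgebra.smul_mem _ (gen_mem_fieldSubalgebra R (S := {X' : Γ' | (e X').1 = β}) hX') _
    · rw [hf, if_neg hX', zero_smul]
      exact Subalgebra.zero_mem _
  | mul a b ha hb => rw [map_mul]; exact Subalgebra.mul_mem _ ha hb
  | add a b ha hb => rw [map_add]; exact Subalgebra.add_mem _ ha hb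

/-- The embedded copy of an even element is even (Berezin 1966, Ch. I §3: substitutions preserve the grading). [cite: Berezin1966, Ch. I §3] -/
theorem map_blockEmb_mem_evenOdd_zero {f : (Γ → R) →ₗ[R] (Γ' → R)} {V : GrassmannAlgebra R Γ} (hV : V ∈ evenOdd R 0) :
    ExteriorAlgebra.map f V ∈ evenOdd R 0 :=
  map_mem_evenOdd_zero R f hV

/-! ### §2 The effective action of one copy and of all copies -/

/-- **One embedded copy integrates as the original**: `Z(C', V ∘ f_β) = Z(C, V)`. [cite: Salmhofer1999, App. B.2 (B.23)-(B.25)] -/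
theorem effPartitionFn_copies_map_blockEmb [Algebra ℚ R] [Fintype Γ] [DecidableEq Γ] [Fintype Γ'] [DecidableEq Γ'] [DecidableEq ι]
    {β : ι} {f : (Γ → R) →ₗ[R] (Γ' → R)} (hf : ∀ v X', f v X' = if (e X').1 = β then v (e X').2 else 0)
    (C : Matrix Γ Γ R) (C' : Matrix Γ' Γ' R)
    (hC' : ∀ X' Y', C' X' Y' = if (e X').1 = (e Y').1 then C (e X').2 (e Y').2 else 0) (V : GrassmannAlgebra R Γ) :
    effPartitionFn R C' (ExteriorAlgebra.map f V) = effPartitionFn R C V := by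
  rw [effPartitionFn_map, transpose_mul_copies_mul_blockEmb e hf C C' hC']

/-- **One embedded copy integrates as the original**: `effAction C' (V ∘ f_β) = (effAction C V) ∘ f_β` — the copies covariance
restricted to block `β` IS `C` (Salmhofer 1999, (4.88) with (B.23)–(B.25)). [cite: Salmhofer1999, §4.3 (4.88)] -/
theorem effAction_copies_map_blockEmb [Algebra ℚ R] [Fintype Γ] [DecidableEq Γ] [Fintype Γ'] [DecidableEq Γ'] [DecidableEq ι]
    {β : ι} {f : (Γ → R) →ₗ[R] (Γ' → R)} (hf : ∀ v X', f v X' = if (e X').1 = β then v (e X').2 else 0)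
    (C : Matrix Γ Γ R) (C' : Matrix Γ' Γ' R)
    (hC' : ∀ X' Y', C' X' Y' = if (e X').1 = (e Y').1 then C (e X').2 (e Y').2 else 0) (V : GrassmannAlgebra R Γ) :
    effAction R C' (ExteriorAlgebra.map f V) = ExteriorAlgebra.map f (effAction R C V) := by
  rw [effAction_map, transpose_mul_copies_mul_blockEmb e hf C C' hC']

/-- **DECOUPLED IDENTICAL COPIES: THE EFFECTIVE ACTION IS THE SUM OF THE EMBEDDED COPIES.**  For the copies covariance `C'` of
`C`, a family of block embeddings `f_β` (`β ∈ s`), and an even interaction `V` without constant part whose partition function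
`Z(C, V)` is a unit: the glued interaction `Σ_{β ∈ s} V ∘ f_β` has a unit partition function and
`effAction C' (Σ_{β ∈ s} V ∘ f_β) = Σ_{β ∈ s} (effAction C V) ∘ f_β` (Salmhofer 1999, (2.102)–(2.106): independent fields integrate
separately; the `b²` decoupled boxes of a torus). [cite: Salmhofer1999, Def. 2.19 (2.102)-(2.106)] -/
theorem effAction_copies_sum [Algebra ℚ R] [Fintype Γ] [DecidableEq Γ] [Fintype Γ'] [DecidableEq Γ'] [DecidableEq ι]
    (C : Matrix Γ Γ R) (C' : Matrix Γ' Γ' R)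
    (hC' : ∀ X' Y', C' X' Y' = if (e X').1 = (e Y').1 then C (e X').2 (e Y').2 else 0)
    (F : ι → (Γ → R) →ₗ[R] (Γ' → R)) (hF : ∀ β v X', F β v X' = if (e X').1 = β then v (e X').2 else 0)
    {V : GrassmannAlgebra R Γ} (hVe : V ∈ evenOdd R 0) (hV0 : constPart R V = 0) (hZ : IsUnit (effPartitionFn R C V))
    (s : Finset ι) :
    IsUnit (effPartitionFn R C' (∑ β ∈ s, ExteriorAlgebra.map (F β) V)) ∧
      effAction R C' (∑ β ∈ s, ExteriorAlgebra.map (F β) V) = ∑ β ∈ s, ExteriorAlgebra.map (F β) (effAction R C V) := by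
  classical
  induction s using Finset.induction_on with
  | empty =>
    have hB : effBoltzmann R C' (0 : GrassmannAlgebra R Γ') = 1 := by
      rw [effBoltzmann_def, neg_zero, grassmannExp, IsNilpotent.exp_zero, gaussConv_one]
    have hZ0 : effPartitionFn R C' (0 : GrassmannAlgebra R Γ') = 1 := by
      rw [effPartitionFn, hB, map_one]
    refine ⟨by rw [sum_empty, hZ0]; exact isUnit_one, ?_⟩
    rw [sum_empty, sum_empty, effAction_def, hZ0, hB, Ring.inverse_one, one_smul, sub_self, grassmannLog1p_zero, neg_zero]
  | insert a s ha ih =>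
    obtain ⟨ihZ, ihA⟩ := ih
    -- the new block `a` and the already glued blocks `s` are decoupled
    have hC₁ : ∀ X' Y', X' ∈ {X' : Γ' | (e X').1 = a} → Y' ∉ {X' : Γ' | (e X').1 = a} → C' X' Y' = 0 := by
      intro X' Y' hX' hY'
      simp only [Set.mem_setOf_eq] at hX' hY'
      rw [hC', if_neg (by rw [hX']; exact Ne.symm hY')]
    have hC₂ : ∀ X' Y', X' ∉ {X' : Γ' | (e X').1 = a} → Y' ∈ {X' : Γ' | (e X').1 = a} → C' X' Y' = 0 := by
      intro X' Y' hX' hY'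
      simp only [Set.mem_setOf_eq] at hX' hY'
      rw [hC', if_neg (by rw [hY']; exact hX')]
    have hV₁ : ExteriorAlgebra.map (F a) V ∈ fieldSubalgebra R {X' : Γ' | (e X').1 = a} :=
      map_blockEmb_mem_fieldSubalgebra e (hF a) V
    have hV₁e : ExteriorAlgebra.map (F a) V ∈ evenOdd R 0 := map_blockEmb_mem_evenOdd_zero hVe
    have hV₁c : constPart R (ExteriorAlgebra.map (F a) V) = 0 := by rw [constPart_map, hV0]
    have hV₂ : ∑ β ∈ s, ExteriorAlgebra.map (F β) V ∈ fieldSubalgebra R {X' : Γ' | (e X').1 = a}ᶜ := by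
      refine Subalgebra.sum_mem _ fun β hβ => fieldSubalgebra_mono R ?_ (map_blockEmb_mem_fieldSubalgebra e (hF β) V)
      intro X' hX'
      simp only [Set.mem_setOf_eq, Set.mem_compl_iff] at hX' ⊢
      rw [hX']
      rintro rfl
      exact ha hβ
    have hV₂c : constPart R (∑ β ∈ s, ExteriorAlgebra.map (F β) V) = 0 := by
      rw [map_sum]
      exact sum_eq_zero fun β _ => by rw [constPart_map, hV0]
    have hZ₁ : IsUnit (effPartitionFn R C' (ExteriorAlgebra.map (F a) V)) := by
      rw [effPartitionFn_copies_map_blockEmb e (hF a) C C' hC']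
      exact hZ
    refine ⟨?_, ?_⟩
    · rw [sum_insert ha, effPartitionFn_add_of_blockDiag R C' hC₁ hC₂ hV₁ hV₁e hV₁c hV₂ hV₂c]
      exact hZ₁.mul ihZ
    · rw [sum_insert ha, sum_insert ha, effAction_add_of_blockDiag R C' hC₁ hC₂ hV₁ hV₁e hV₁c hV₂ hV₂c hZ₁ ihZ, ihA,
        effAction_copies_map_blockEmb e (hF a) C C' hC']

/-! ### §3 Kernels and pinned leg sums of the glued element -/

/-- **Kernels of one embedded copy**: `kernel (W ∘ f_β) m X' = [all legs in block β] · kernel W m (π ∘ X')` (the coefficients of a substituted element, Berezin 1966, Ch. I §3; Salmhofer 1999, (B.23)). [cite: Berezin1966, Ch. I §3] -/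
theorem kernel_map_blockEmb [Algebra ℚ R] [Fintype Γ] [DecidableEq Γ] [DecidableEq Γ'] [DecidableEq ι] {β : ι}
    {f : (Γ → R) →ₗ[R] (Γ' → R)} (hf : ∀ v X', f v X' = if (e X').1 = β then v (e X').2 else 0)
    (W : GrassmannAlgebra R Γ) (m : ℕ) (X' : Fin m → Γ') :
    kernel R (ExteriorAlgebra.map f W) m X' =
      if ∀ i, (e (X' i)).1 = β then kernel R W m (fun i => (e (X' i)).2) else 0 := by
  rw [kernel_map]
  simp only [toMatrix'_blockEmb e hf]
  split_ifs with h
  · rw [Finset.sum_eq_single (fun i => (e (X' i)).2)]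
    · rw [prod_eq_one fun i _ => ?_, one_mul]
      dsimp only
      rw [if_pos (show e (X' i) = (β, (e (X' i)).2) from Prod.ext (h i) rfl)]
    · intro X _ hX
      obtain ⟨i, hi⟩ : ∃ i, (e (X' i)).2 ≠ X i := by
        by_contra hc
        push Not at hc
        exact hX (funext fun i => (hc i).symm)
      rw [prod_eq_zero (mem_univ i) (by rw [if_neg fun h' => hi (by rw [h'])]), zero_mul]
    · exact fun h' => (h' (mem_univ _)).elim
  · push Not at h
    obtain ⟨i, hi⟩ := h
    exact sum_eq_zero fun X _ => by rw [prod_eq_zero (mem_univ i) (by rw [if_neg fun h' => hi (by rw [h'])]), zero_mul]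

/-- **Kernels of the glued element**: with one independent copy per block, `kernel (Σ_β W ∘ f_β) m X'` vanishes unless all legs
of `X'` lie in ONE block, where it is `kernel W m (π ∘ X')` (read at any leg `j`; Salmhofer 1999, (2.106): the effective action of decoupled systems has no kernels coupling them). [cite: Salmhofer1999, Def. 2.19 (2.102)-(2.106)] -/
theorem kernel_copies_sum [Algebra ℚ R] [Fintype Γ] [DecidableEq Γ] [DecidableEq Γ'] [Fintype ι] [DecidableEq ι]
    (F : ι → (Γ → R) →ₗ[R] (Γ' → R)) (hF : ∀ β v X', F β v X' = if (e X').1 = β then v (e X').2 else 0)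
    (W : GrassmannAlgebra R Γ) {m : ℕ} (j : Fin m) (X' : Fin m → Γ') :
    kernel R (∑ β, ExteriorAlgebra.map (F β) W) m X' =
      if ∀ i, (e (X' i)).1 = (e (X' j)).1 then kernel R W m (fun i => (e (X' i)).2) else 0 := by
  rw [kernel_sum]
  simp only [kernel_map_blockEmb e (hF _)]
  split_ifs with h
  · rw [Finset.sum_eq_single (e (X' j)).1]
    · rw [if_pos h]
    · intro β _ hβ
      rw [if_neg]
      intro h'
      exact hβ (h' j).symm
    · exact fun h' => (h' (mem_univ _)).elim
  · refine sum_eq_zero fun β _ => ?_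
    rw [if_neg]
    intro h'
    exact h fun i => by rw [h' i, h' j]

/-- **Pinned leg sums of the glued element are those of one copy.**  For every leg `j`, pin `w'`, and weight `g` with `g X' 0 = 0`:
`Σ_{X' : X'_j = w'} g X' (kernel (Σ_β W ∘ f_β) m X') = Σ_{X : X_j = π w'} g (lift X) (kernel W m X)`, `lift X = e⁻¹ ∘ (blk w', X ·)` —
in particular the pinned `L¹` profiles, leg-`0` profiles and first moments of `b²` decoupled copies of an effective action are
those of one copy (Salmhofer 1999, (2.106)). [cite: Salmhofer1999, Def. 2.19 (2.102)-(2.106)] -/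
theorem sum_pinned_kernel_copies_sum [Algebra ℚ R] [Fintype Γ] [DecidableEq Γ] [Fintype Γ'] [DecidableEq Γ'] [Fintype ι]
    [DecidableEq ι] {A : Type*} [AddCommMonoid A] (F : ι → (Γ → R) →ₗ[R] (Γ' → R))
    (hF : ∀ β v X', F β v X' = if (e X').1 = β then v (e X').2 else 0) (W : GrassmannAlgebra R Γ) {m : ℕ} (j : Fin m)
    (w' : Γ') (g : (Fin m → Γ') → R → A) (hg : ∀ X', g X' 0 = 0) :
    ∑ X' ∈ univ.filter (fun X' : Fin m → Γ' => X' j = w'), g X' (kernel R (∑ β, ExteriorAlgebra.map (F β) W) m X') =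
      ∑ X ∈ univ.filter (fun X : Fin m → Γ => X j = (e w').2),
        g (fun i => e.symm ((e w').1, X i)) (kernel R W m X) := by
  classical
  -- drop the strings whose legs are not all in the block of the pin
  have hstep : ∑ X' ∈ univ.filter (fun X' : Fin m → Γ' => X' j = w'), g X' (kernel R (∑ β, ExteriorAlgebra.map (F β) W) m X') =
      ∑ X' ∈ univ.filter (fun X' : Fin m → Γ' => X' j = w' ∧ ∀ i, (e (X' i)).1 = (e w').1),
        g X' (kernel R W m (fun i => (e (X' i)).2)) := by
    rw [← Finset.sum_filter_add_sum_filter_not (univ.filter (fun X' : Fin m → Γ' => X' j = w'))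
      (fun X' : Fin m → Γ' => ∀ i, (e (X' i)).1 = (e w').1), Finset.filter_filter]
    have hzero : ∑ X' ∈ (univ.filter (fun X' : Fin m → Γ' => X' j = w')).filter
        (fun X' : Fin m → Γ' => ¬ ∀ i, (e (X' i)).1 = (e w').1), g X' (kernel R (∑ β, ExteriorAlgebra.map (F β) W) m X') = 0 := by
      refine sum_eq_zero fun X' hX' => ?_
      simp only [mem_filter, mem_univ, true_and] at hX'
      obtain ⟨hXj, hXb⟩ := hX'
      rw [kernel_copies_sum e F hF W j, if_neg (by rw [hXj]; exact hXb), hg]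
    rw [hzero, add_zero]
    refine sum_congr rfl fun X' hX' => ?_
    simp only [mem_filter, mem_univ, true_and] at hX'
    obtain ⟨hXj, hXb⟩ := hX'
    rw [kernel_copies_sum e F hF W j, if_pos (by rw [hXj]; exact hXb)]
  rw [hstep]
  -- the remaining strings are the lifts of the strings of `Γ` pinned at `π w'`
  refine Finset.sum_bij' (fun X' _ => fun i => (e (X' i)).2) (fun X _ => fun i => e.symm ((e w').1, X i)) ?_ ?_ ?_ ?_ ?_
  · intro X' hX'
    simp only [mem_filter, mem_univ, true_and] at hX' ⊢
    rw [hX'.1]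
  · intro X hX
    simp only [mem_filter, mem_univ, true_and] at hX ⊢
    refine ⟨?_, fun i => ?_⟩
    · have h1 : e.symm ((e w').1, X j) = e.symm (e w') := by rw [hX]
      rw [h1, Equiv.symm_apply_apply]
    · rw [Equiv.apply_symm_apply]
  · intro X' hX'
    simp only [mem_filter, mem_univ, true_and] at hX'
    funext i
    have h2 : ((e w').1, (e (X' i)).2) = e (X' i) := by rw [← hX'.2 i]
    rw [h2, Equiv.symm_apply_apply]
  · intro X hX
    funext i
    rw [Equiv.apply_symm_apply]
  · intro X' hX'
    simp only [mem_filter, mem_univ, true_and] at hX'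
    have h3 : (fun i => e.symm ((e w').1, (fun i => (e (X' i)).2) i)) = X' := by
      funext i
      dsimp only
      have h2 : ((e w').1, (e (X' i)).2) = e (X' i) := by rw [← hX'.2 i]
      rw [h2, Equiv.symm_apply_apply]
    rw [h3]

end Copies

end Literature.MathematicalPhysics.QuantumLattice

end
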